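/-
Copyright: cell `langlands-arthur-audit` (papers/Langlands/langlands-arthur-audit), unit `pub-arthur-typer-g5`
(LEAN TYPER gen 5, 2026-08-18).  Staged for the tree under `Literature/NumberTheory/Automorphic/Arthur2013/Leaves/`
(LEAN-IN-TREE rule 2026-08-18); imports the [Ar] and [Mok] DAG modules (M1, M10) and `Leaves.Intertwining` (M24),
`Leaves.GlobalSeed` (M25).  Module map: M26.
-/
import Literature.NumberTheory.Automorphic.Arthur2013.DependencyDag
import Literature.NumberTheory.Automorphic.Mok2015.DependencyDag
import Literature.NumberTheory.Automorphic.Arthur2013.Leaves.Intertwining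
import Literature.NumberTheory.Automorphic.Arthur2013.Leaves.GlobalSeed

/-!
# Arthur (2013) audit, typed leaves — §13 FULL-CONTENT READINGS of the remaining DAG nodes (T221, T224, T241, T244, T141, T142, T153, T422; [Mok] T321, T343, T242, T2410, T254, T521) and of the preprint leaves AGIKMS 1.10.5 / D.2.1

Completes the pattern of `BridgeFull` (M22: T151 / [Mok] T251 / [KMSW] T161) and `BridgeFullGlobal` (M23: T152,
T412 / [Mok] T252, T512 / [KMSW] T171) for the nodes the cell's carver lists as lacking a content-carrying reading
(GAPS G-CV-g4-8; LEMMAS.md §5): as HYPOTHESES a reader may adopt, the opaque nodes of `Arthur2013.Nodes` /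
`Mok2015.Nodes` (conjunction over all ranks `N`, as in M22) ARE the typed statements of §11 (`Intertwining`, M24)
and §12 (`GlobalSeed`, M25); and the two AGIKMS preprint leaves that §11 types with content (`AGIKMS_1105` = Thm
1.10.5 under Hyp. 1.10.4, `AGIKMS_D21` = Thm D.2.1) ARE `AGIKMS.Main3C` / `AGIKMS.ThmD21C`.  Proved here:

* `Book.localRest_of_leaves`, `Book.globalRest_of_leaves`, `Mok.localRest_of_leaves`, `Mok.globalRest_of_leaves`
  — under the readings, the typed theorems follow from EXACTLY the leaf bundles of the respective kernel DAG
  (`Arthur2013.Nodes.main_of_leaves`, `Mok2015.Nodes.main_of_leaves`); no new leaf;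
* `Book.alir_of_leaves` — in particular (A-LIR) for EVERY `u` on the Book's region (`Book.T241_and_T244_iff`);
* `Book.preprint_content` — what granting the bundle `PreprintLeaves2026` commits a reader to, in typed content,
  for the two leaves typed so far (the scope of that content is §6's `L16.supplied` / `L19.supplied`:
  non-archimedean, quasi-split — `lir_regions_decide`, `L16.strict`);
* `…restNodes_reads` — the readings are CONSISTENT (a node assignment satisfying them exists).

T221 is read for a GIVEN packet assignment `Pk` (the packets Thm 2.2.4 refines and (LIR) evaluates are those of
Thm 2.2.1), i.e. as `TwistedCharIdentity ∧ EndoscopicCharRelations Pk E` on `Book.localStated`, which gives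
§11's existential `Book.T221b` (`Book.T221b_of_reading`).  T422 is read ONLY under the DAG's own gloss (global
intertwining relation, `Book.T422asGIR`; identification with [Ar, Thm 4.2.2] UNVERIFIED, LEMMAS.md §6 Q1).
Nothing here asserts that any node is true or touches a landed statement.  The Book `Arthur2013` is NOT held by
the cell (acq-04129): every "[Ar, x.y.z]" is the second-hand locator of M24 / M25.  No `axiom`, `sorry`,
`opaque`; no Mathlib.
-/

set_option autoImplicit false

namespace Literature.NumberTheory.Automorphic.Arthur2013.Leaves

section RestReads

variable {Ω : World} {D : ShapeData Ω}

/-- **Readings of the remaining LOCAL nodes of the [Ar] DAG** (at every rank) as the typed statements of M24: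
T221 = Thm 2.2.1 (a)+(b) for the assignment `Pk` ([TIFR] Thm 1′, `[paper:url-560716e7679e pp.11-12]`); T224 =
the even-orthogonal refinement ([AGIKMS] `note30.tex:L1577–L1599`); T241 / T244 = (A-LIR) for `w̃_u ∈ G°` /
`w̃_u ∉ G°` ([AGIKMS] `L2211–L2221`; [Mok] Thm 3.4.3).
[cite: Arthur2013, Thms 2.2.1, 2.2.4, 2.4.1, 2.4.4 (reading hypotheses over Leaves/Intertwining; second-hand locators as there)] -/
structure Book.ReadsLocalRest (ν : Nodes) (Ω : World) (D : ShapeData Ω) (Pk : PacketAssignment Ω D)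
    (E : EndoData Ω D) (O : OrthData Ω) (I : LeviData Ω D) : Prop where
  /-- T221 at every rank ↔ Thm 2.2.1 (a) and (b) for `Pk` on `Book.localStated` -/
  t221 : (∀ N, ν.T221 N) ↔ (TwistedCharIdentity Ω Book.localStated ∧ EndoscopicCharRelations Pk E Book.localStated)
  /-- T224 at every rank ↔ the even-orthogonal refinement of `Pk` -/
  t224 : (∀ N, ν.T224 N) ↔ Book.T224 Ω D Pk O
  /-- T241 at every rank ↔ (A-LIR), `w̃_u ∈ G°` -/
  t241 : (∀ N, ν.T241 N) ↔ Book.T241 Ω D I E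
  /-- T244 at every rank ↔ (A-LIR), `w̃_u ∉ G°` -/
  t244 : (∀ N, ν.T244 N) ↔ Book.T244 Ω D I E

/-- **Readings of the remaining GLOBAL nodes of the [Ar] DAG** as the typed statements of M25: T141 / T142 = the
seed theorems (Taïbi's restatement, `cpctmult.tex:L258–L269`), T153 = [TIFR] Theorem 3 (p.7), T422 = the global
intertwining relation UNDER THE DAG'S GLOSS (`Book.T422asGIR`).
[cite: Arthur2013, Thms 1.4.1, 1.4.2, 1.5.3, 4.2.2 (reading hypotheses over Leaves/GlobalSeed; T422 identification UNVERIFIED)] -/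
structure Book.ReadsGlobalRest (ν : Nodes) (S : SeedWorld) (Γ : GlobalWorld) (GI : GlobalLeviData Γ) : Prop where
  /-- T141 at every rank ↔ Thm 1.4.1 -/
  t141 : (∀ N, ν.T141 N) ↔ Book.T141 S
  /-- T142 at every rank ↔ Thm 1.4.2 -/
  t142 : (∀ N, ν.T142 N) ↔ Book.T142 S
  /-- T153 at every rank ↔ Thm 1.5.3 -/
  t153 : (∀ N, ν.T153 N) ↔ Book.T153 S
  /-- T422 at every rank ↔ the global intertwining relation on `Book.globalScope` (DAG gloss) -/
  t422 : (∀ N, ν.T422 N) ↔ Book.T422asGIR Γ GI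

/-- **Readings of the two content-typed AGIKMS preprint leaves of the [Ar] DAG**: `AGIKMS_1105` (Thm 1.10.5 under
Hyp. 1.10.4, `note30.tex:L2327–L2362`) = `AGIKMS.Main3C`; `AGIKMS_D21` (Thm D.2.1, `L13341–L13413`) =
`AGIKMS.ThmD21C` with supplementary premise `suppl`.
[claim: AGIKMS2024, under-review] (reading hypotheses over Leaves/Intertwining) -/
structure Book.ReadsAGIKMS (ν : Nodes) (Ω : World) (D : ShapeData Ω) (Pk : PacketAssignment Ω D)
    (E : EndoData Ω D) (I : LeviData Ω D)
    (suppl : (s : LocalClassicalScope) → (L : I.Levi s) → I.ParamM s L → Prop) : Prop where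
  /-- leaf AGIKMS Thm 1.10.5 ↔ `Main3C` -/
  l1105 : ν.AGIKMS_1105 ↔ AGIKMS.Main3C Pk I E
  /-- leaf AGIKMS Thm D.2.1 ↔ `ThmD21C` -/
  lD21 : ν.AGIKMS_D21 ↔ AGIKMS.ThmD21C I E suppl

/-- **Readings of the remaining nodes of the [Mok] DAG** as the typed statements of M24 / M25: T321 = Thm 3.2.1
for `Pk`; T343 = Thm 3.4.3 (`main.tex:L2787–L2796`); T242 / T2410 = Thms 2.4.2 / 2.4.10 (`L826–L832`, `L1101–
L1105`); T254 = Thm 2.5.4 (`L1380–L1395`); T521 = Thm 5.2.1 (`L4189–L4206`).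
[cite: Mok2012, Thms 3.2.1, 3.4.3, 2.4.2, 2.4.10, 2.5.4, 5.2.1 (reading hypotheses over Leaves/Intertwining, Leaves/GlobalSeed)] -/
structure Mok.ReadsRest (μ : Mok2015.Nodes) (Ω : World) (D : ShapeData Ω) (Pk : PacketAssignment Ω D)
    (E : EndoData Ω D) (I : LeviData Ω D) (S : SeedWorld) (Γ : GlobalWorld) (GI : GlobalLeviData Γ) : Prop where
  /-- T321 at every rank ↔ Thm 3.2.1 for `Pk` on `Mok.localStated` -/
  t321 : (∀ N, μ.T321 N) ↔ (TwistedCharIdentity Ω Mok.localStated ∧ EndoscopicCharRelations Pk E Mok.localStated)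
  /-- T343 at every rank ↔ Thm 3.4.3 -/
  t343 : (∀ N, μ.T343 N) ↔ Mok.T343 Ω D I E
  /-- T242 at every rank ↔ Thm 2.4.2 -/
  t242 : (∀ N, μ.T242 N) ↔ Mok.T242 S
  /-- T2410 at every rank ↔ Thm 2.4.10 -/
  t2410 : (∀ N, μ.T2410 N) ↔ Mok.T2410 S
  /-- T254 at every rank ↔ Thm 2.5.4 -/
  t254 : (∀ N, μ.T254 N) ↔ Mok.T254 S
  /-- T521 at every rank ↔ Thm 5.2.1 -/
  t521 : (∀ N, μ.T521 N) ↔ Mok.T521 Γ GI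

variable {Pk : PacketAssignment Ω D} {E : EndoData Ω D} {O : OrthData Ω} {I : LeviData Ω D}
variable {S : SeedWorld} {Γ : GlobalWorld} {GI : GlobalLeviData Γ}

/-- The fixed-assignment reading of T221 gives §11's existential `Book.T221b`. [folklore] (bookkeeping) -/
theorem Book.T221b_of_reading {ν : Nodes} (h : Book.ReadsLocalRest ν Ω D Pk E O I) (H : ∀ N, ν.T221 N) :
    Book.T221b Ω D E :=
  ⟨(h.t221.mp H).1, Pk, (h.t221.mp H).2⟩

/-- **[Ar] Thms 2.2.1, 2.2.4, 2.4.1, 2.4.4 WITH CONTENT from the leaves.**  Under the readings, the typed local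
theorems follow from the book-internal edges, the supply edges and EXACTLY the three leaf bundles of the kernel
DAG (M1 `Nodes.main_of_leaves`, local half `LocalAll N = T151 ∧ T221 ∧ T224 ∧ T241 ∧ T244`); their 2026 status is
that of the leaf set (LEMMAS.md §2), with no new leaf.
[cite: Arthur2013, Thms 2.2.1/2.2.4/2.4.1/2.4.4 (bookkeeping proved here; second-hand locators as in Leaves/Intertwining)] -/
theorem Book.localRest_of_leaves {ν : Nodes} (h : Book.ReadsLocalRest ν Ω D Pk E O I) (B : ν.BookEdges)
    (Sd : ν.SupplyEdges) (P : ν.PublishedLeaves) (Q : ν.PreprintLeaves2026) (U : ν.UnwrittenLeaves) :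
    (TwistedCharIdentity Ω Book.localStated ∧ EndoscopicCharRelations Pk E Book.localStated) ∧
      Book.T224 Ω D Pk O ∧ Book.T241 Ω D I E ∧ Book.T244 Ω D I E :=
  have hAll := ν.main_of_leaves B Sd P Q U
  ⟨h.t221.mp fun N => (hAll N).1.2.1, h.t224.mp fun N => (hAll N).1.2.2.1,
    h.t241.mp fun N => (hAll N).1.2.2.2.1, h.t244.mp fun N => (hAll N).1.2.2.2.2⟩

/-- **(A-LIR) for every `u` on the Book's region from the leaves** (T241 and T244 together, `Book.T241_and_T244_iff`).
[cite: Arthur2013, Thms 2.4.1 + 2.4.4 jointly (bookkeeping proved here)] -/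
theorem Book.alir_of_leaves {ν : Nodes} (h : Book.ReadsLocalRest ν Ω D Pk E O I) (B : ν.BookEdges)
    (Sd : ν.SupplyEdges) (P : ν.PublishedLeaves) (Q : ν.PreprintLeaves2026) (U : ν.UnwrittenLeaves) :
    LocalIntertwining I E fun s _ _ => Book.localStated s :=
  have hL := Book.localRest_of_leaves h B Sd P Q U
  (Book.T241_and_T244_iff Ω D I E).mp ⟨hL.2.2.1, hL.2.2.2⟩

/-- **[Ar] Thms 1.4.1, 1.4.2, 1.5.3 and node T422 WITH CONTENT from the leaves** (global half `GlobalAll N = T141 ∧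
T142 ∧ T152 ∧ T153 ∧ T412 ∧ T422` of M1 `Nodes.main_of_leaves`).
[cite: Arthur2013, Thms 1.4.1/1.4.2/1.5.3/4.2.2 (bookkeeping proved here; T422 under the DAG gloss only)] -/
theorem Book.globalRest_of_leaves {ν : Nodes} (h : Book.ReadsGlobalRest ν S Γ GI) (B : ν.BookEdges)
    (Sd : ν.SupplyEdges) (P : ν.PublishedLeaves) (Q : ν.PreprintLeaves2026) (U : ν.UnwrittenLeaves) :
    Book.T141 S ∧ Book.T142 S ∧ Book.T153 S ∧ Book.T422asGIR Γ GI :=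
  have hAll := ν.main_of_leaves B Sd P Q U
  ⟨h.t141.mp fun N => (hAll N).2.1, h.t142.mp fun N => (hAll N).2.2.1,
    h.t153.mp fun N => (hAll N).2.2.2.2.1, h.t422.mp fun N => (hAll N).2.2.2.2.2.2⟩

/-- **What granting the preprint bundle commits a reader to, in typed content**: under the AGIKMS readings, the
bundle `PreprintLeaves2026` of M1 contains `AGIKMS.Main3C` (packets with (ECR1), (ECR2) and (LIR) for co-tempered
parameters at NON-ARCHIMEDEAN QUASI-SPLIT scopes, under `HypArthurC`) and `AGIKMS.ThmD21C` (weak LIR with a scalar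
⟹ (A-LIR), tempered, non-archimedean quasi-split, under `suppl`).
[claim: AGIKMS2024, under-review] (bookkeeping proved here) -/
theorem Book.preprint_content {ν : Nodes}
    {suppl : (s : LocalClassicalScope) → (L : I.Levi s) → I.ParamM s L → Prop}
    (h : Book.ReadsAGIKMS ν Ω D Pk E I suppl) (Q : ν.PreprintLeaves2026) :
    AGIKMS.Main3C Pk I E ∧ AGIKMS.ThmD21C I E suppl :=
  ⟨h.l1105.mp Q.agikms1105, h.lD21.mp Q.agikmsD21⟩

/-- **[Mok] Thms 3.2.1, 3.4.3, 2.4.2, 2.4.10, 2.5.4, 5.2.1 WITH CONTENT from the leaves** of the [Mok] DAG (M10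
`Mok2015.Nodes.main_of_leaves`: `LocalAll N = T251 ∧ T321 ∧ T343`, `GlobalAll N = T242 ∧ T2410 ∧ T252 ∧ T254 ∧
T512 ∧ T521`). [cite: Mok2012, Thms 3.2.1/3.4.3/2.4.2/2.4.10/2.5.4/5.2.1 (bookkeeping proved here)] -/
theorem Mok.rest_of_leaves {μ : Mok2015.Nodes} (h : Mok.ReadsRest μ Ω D Pk E I S Γ GI) (B : μ.SectionEdges)
    (Sd : μ.SupplyEdges) (P : μ.PublishedLeaves) (Q : μ.PreprintLeaves2026) (U : μ.UnwrittenLeaves) :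
    ((TwistedCharIdentity Ω Mok.localStated ∧ EndoscopicCharRelations Pk E Mok.localStated) ∧ Mok.T343 Ω D I E) ∧
      (Mok.T242 S ∧ Mok.T2410 S ∧ Mok.T254 S ∧ Mok.T521 Γ GI) :=
  have hAll := μ.main_of_leaves B Sd P Q U
  ⟨⟨h.t321.mp fun N => (hAll N).1.2.1, h.t343.mp fun N => (hAll N).1.2.2⟩,
    ⟨h.t242.mp fun N => (hAll N).2.1, h.t2410.mp fun N => (hAll N).2.2.1,
      h.t254.mp fun N => (hAll N).2.2.2.2.1, h.t521.mp fun N => (hAll N).2.2.2.2.2.2⟩⟩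

/-- [Mok] Thm 3.2.1 in §11's existential form from the reading. [folklore] (bookkeeping) -/
theorem Mok.T321_of_reading {μ : Mok2015.Nodes} (h : Mok.ReadsRest μ Ω D Pk E I S Γ GI) (H : ∀ N, μ.T321 N) :
    Mok.T321 Ω D E :=
  ⟨(h.t321.mp H).1, Pk, (h.t321.mp H).2⟩

/-- A node assignment of the [Ar] DAG reading the remaining nodes and the two AGIKMS leaves with content (all other
nodes arbitrary). [folklore] (consistency witness) -/
def Book.restNodes (Ω : World) (D : ShapeData Ω) (Pk : PacketAssignment Ω D) (E : EndoData Ω D) (O : OrthData Ω)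
    (I : LeviData Ω D) (suppl : (s : LocalClassicalScope) → (L : I.Levi s) → I.ParamM s L → Prop)
    (S : SeedWorld) (Γ : GlobalWorld) (GI : GlobalLeviData Γ) (rest : Nodes) : Nodes :=
  { rest with
    T221 := fun _ => TwistedCharIdentity Ω Book.localStated ∧ EndoscopicCharRelations Pk E Book.localStated
    T224 := fun _ => Book.T224 Ω D Pk O
    T241 := fun _ => Book.T241 Ω D I E
    T244 := fun _ => Book.T244 Ω D I E
    T141 := fun _ => Book.T141 S
    T142 := fun _ => Book.T142 S
    T153 := fun _ => Book.T153 S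
    T422 := fun _ => Book.T422asGIR Γ GI
    AGIKMS_1105 := AGIKMS.Main3C Pk I E
    AGIKMS_D21 := AGIKMS.ThmD21C I E suppl }

/-- The readings of the [Ar] nodes are CONSISTENT: `Book.restNodes` satisfies all three. [folklore] (consistency) -/
theorem Book.restNodes_reads (Ω : World) (D : ShapeData Ω) (Pk : PacketAssignment Ω D) (E : EndoData Ω D)
    (O : OrthData Ω) (I : LeviData Ω D)
    (suppl : (s : LocalClassicalScope) → (L : I.Levi s) → I.ParamM s L → Prop)
    (S : SeedWorld) (Γ : GlobalWorld) (GI : GlobalLeviData Γ) (rest : Nodes) :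
    Book.ReadsLocalRest (Book.restNodes Ω D Pk E O I suppl S Γ GI rest) Ω D Pk E O I ∧
      Book.ReadsGlobalRest (Book.restNodes Ω D Pk E O I suppl S Γ GI rest) S Γ GI ∧
      Book.ReadsAGIKMS (Book.restNodes Ω D Pk E O I suppl S Γ GI rest) Ω D Pk E I suppl :=
  ⟨{ t221 := ⟨fun H => H 0, fun H _ => H⟩, t224 := ⟨fun H => H 0, fun H _ => H⟩,
     t241 := ⟨fun H => H 0, fun H _ => H⟩, t244 := ⟨fun H => H 0, fun H _ => H⟩ },
   { t141 := ⟨fun H => H 0, fun H _ => H⟩, t142 := ⟨fun H => H 0, fun H _ => H⟩,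
     t153 := ⟨fun H => H 0, fun H _ => H⟩, t422 := ⟨fun H => H 0, fun H _ => H⟩ },
   { l1105 := Iff.rfl, lD21 := Iff.rfl }⟩

/-- A node assignment of the [Mok] DAG reading the remaining nodes with content. [folklore] (consistency witness) -/
def Mok.restNodes (Ω : World) (D : ShapeData Ω) (Pk : PacketAssignment Ω D) (E : EndoData Ω D) (I : LeviData Ω D)
    (S : SeedWorld) (Γ : GlobalWorld) (GI : GlobalLeviData Γ) (rest : Mok2015.Nodes) : Mok2015.Nodes :=
  { rest with
    T321 := fun _ => TwistedCharIdentity Ω Mok.localStated ∧ EndoscopicCharRelations Pk E Mok.localStated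
    T343 := fun _ => Mok.T343 Ω D I E
    T242 := fun _ => Mok.T242 S
    T2410 := fun _ => Mok.T2410 S
    T254 := fun _ => Mok.T254 S
    T521 := fun _ => Mok.T521 Γ GI }

/-- The readings of the [Mok] nodes are CONSISTENT. [folklore] (consistency) -/
theorem Mok.restNodes_reads (Ω : World) (D : ShapeData Ω) (Pk : PacketAssignment Ω D) (E : EndoData Ω D)
    (I : LeviData Ω D) (S : SeedWorld) (Γ : GlobalWorld) (GI : GlobalLeviData Γ) (rest : Mok2015.Nodes) :
    Mok.ReadsRest (Mok.restNodes Ω D Pk E I S Γ GI rest) Ω D Pk E I S Γ GI where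
  t321 := ⟨fun H => H 0, fun H _ => H⟩
  t343 := ⟨fun H => H 0, fun H _ => H⟩
  t242 := ⟨fun H => H 0, fun H _ => H⟩
  t2410 := ⟨fun H => H 0, fun H _ => H⟩
  t254 := ⟨fun H => H 0, fun H _ => H⟩
  t521 := ⟨fun H => H 0, fun H _ => H⟩

end RestReads

end Literature.NumberTheory.Automorphic.Arthur2013.Leaves
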